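import Literature.NumberTheory.EllipticCurves.ZpExtensionCoeffTwistCores
import HarnessLib

/-!
# Composition and congruence of the coefficient/module changes `coeffTwistReduce` (theorems only)

Topic `NumberTheory/EllipticCurves` (sequel of `ZpExtensionCoeffTwistCores`). Cell `pub/bsd-print-x9`, seat `bsd-line-x9-p2`
(g3): the `f_red` / `fq_rq` compatibilities of a `CoeffTowerSetting.Hom` out of the `Λ`-adic source (lit `TowerMorphism`,
x9-p1 LEAD g3's pushforward) equate two composites of maps of the shape `coeffTwistReduce φ f`
(`f_k ∘ red_{σ} = red′_k ∘ f_{k+1}`); both sides are `coeffTwistReduce` along composite data, and two such maps agree as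
soon as their ring maps agree and their module maps agree pointwise. This file records exactly that:

* `coeffTwistReduce_comp_apply` : `coeffTwistReduce φ′ f′ (coeffTwistReduce φ f x) = coeffTwistReduce (φ′ ∘ φ) (f′ ∘ f) x`;
* `coeffTwistReduce_congr` : equal ring maps and pointwise-equal module maps give equal values;
* `coeffTwistReduce_comp_eq_of` : the square `f′ ∘ r = r′ ∘ f` for four `coeffTwistReduce`s from the two identities of data;
* `coeffTwistReduce_id_apply` : along `RingHom.id` and the identity the change is the identity.
Theorems only; no `sorry`. BSD is not proved by any of this.

References: [Howard2004HeegnerKolyvagin] B. Howard, Compositio Math. 140 (2004), Rem. 1.2.4 (arXiv Rem. 2.2.4, p. 7, L13–27) and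
§1.6 (arXiv p. 12, L29–33); [Washington1997] §13.1.
-/

noncomputable section

open scoped TensorProduct ContRepresentation
open Field

namespace Literature.NumberTheory.EllipticCurves.ZpExtension

open Literature.NumberTheory.GaloisRepresentations

universe u

variable {K : Type u} [Field K] {p : ℕ} [hp : Fact p.Prime] (κ : ZpExtension K p)
  {M₁ : Type u} [AddCommGroup M₁] [TopologicalSpace M₁] [DiscreteTopology M₁] {ρ₁ : DiscreteGaloisModule K M₁}
  {M₂ : Type u} [AddCommGroup M₂] [TopologicalSpace M₂] [DiscreteTopology M₂] {ρ₂ : DiscreteGaloisModule K M₂}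
  {M₃ : Type u} [AddCommGroup M₃] [TopologicalSpace M₃] [DiscreteTopology M₃] {ρ₃ : DiscreteGaloisModule K M₃}
  {A₁ : Type} [CommRing A₁] {u₁ : A₁} {J₁ : ℕ} (hu₁ : u₁ ^ (p ^ J₁) = 1)
  {A₂ : Type} [CommRing A₂] {u₂ : A₂} {J₂ : ℕ} (hu₂ : u₂ ^ (p ^ J₂) = 1)
  {A₃ : Type} [CommRing A₃] {u₃ : A₃} {J₃ : ℕ} (hu₃ : u₃ ^ (p ^ J₃) = 1)

/-- **Composition of coefficient/module changes**: `coeffTwistReduce φ′ f′ ∘ coeffTwistReduce φ f = coeffTwistReduce (φ′∘φ) (f′∘f)`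
(both sides additive and equal on pure tensors). [cite: Howard2004HeegnerKolyvagin, Rem. 1.2.4 and §1.6 (arXiv p. 12, L29–33)] -/
theorem coeffTwistReduce_comp_apply (φ : A₁ →+* A₂) (hφ : φ u₁ = u₂) (φ' : A₂ →+* A₃) (hφ' : φ' u₂ = u₃)
    (f : ρ₁.toContRepresentation →ⁱL ρ₂.toContRepresentation) (f' : ρ₂.toContRepresentation →ⁱL ρ₃.toContRepresentation)
    (x : CoeffExtension ℤ A₁ M₁) :
    κ.coeffTwistReduce hu₂ hu₃ φ' hφ' f' (κ.coeffTwistReduce hu₁ hu₂ φ hφ f x) =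
      κ.coeffTwistReduce hu₁ hu₃ (φ'.comp φ) (by rw [RingHom.comp_apply, hφ, hφ']) (f'.comp f) x := by
  induction x using CoeffExtension.induction_on with
  | zero => simp only [map_zero]
  | tmul c a =>
    rw [coeffTwistReduce_tmul, coeffTwistReduce_tmul, coeffTwistReduce_tmul]
    rfl
  | add x y hx hy => rw [map_add, map_add, hx, hy, map_add]

/-- **Congruence**: two coefficient/module changes with the same ring map and pointwise-equal module maps agree.
[cite: Howard2004HeegnerKolyvagin, Rem. 1.2.4] -/
theorem coeffTwistReduce_congr {φ φ' : A₁ →+* A₂} (hφ : φ u₁ = u₂) (hφ' : φ' u₁ = u₂) (hφφ : φ = φ')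
    {f f' : ρ₁.toContRepresentation →ⁱL ρ₂.toContRepresentation} (hff : ∀ a, f a = f' a) (x : CoeffExtension ℤ A₁ M₁) :
    κ.coeffTwistReduce hu₁ hu₂ φ hφ f x = κ.coeffTwistReduce hu₁ hu₂ φ' hφ' f' x := by
  subst hφφ
  induction x using CoeffExtension.induction_on with
  | zero => simp only [map_zero]
  | tmul c a => rw [coeffTwistReduce_tmul, coeffTwistReduce_tmul, hff]
  | add x y hx hy => rw [map_add, map_add, hx, hy]

/-- Along `RingHom.id` and a pointwise-identity module map the change is the identity. [cite: Howard2004HeegnerKolyvagin, Rem. 1.2.4] -/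
theorem coeffTwistReduce_id_apply {f : ρ₁.toContRepresentation →ⁱL ρ₁.toContRepresentation} (hf : ∀ a, f a = a)
    (x : CoeffExtension ℤ A₁ M₁) :
    κ.coeffTwistReduce hu₁ hu₁ (RingHom.id A₁) rfl f x = x := by
  induction x using CoeffExtension.induction_on with
  | zero => simp only [map_zero]
  | tmul c a => rw [coeffTwistReduce_tmul, hf]; rfl
  | add x y hx hy => rw [map_add, hx, hy]

variable {A₄ : Type} [CommRing A₄] {u₄ : A₄} {J₄ : ℕ} (hu₄ : u₄ ^ (p ^ J₄) = 1)
  {M₄ : Type u} [AddCommGroup M₄] [TopologicalSpace M₄] [DiscreteTopology M₄] {ρ₄ : DiscreteGaloisModule K M₄}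

/-- **The commuting square of a tower morphism** (`Hom.f_red` shape): given ring maps `φ₁₂ : A₁ → A₂` (source reduction),
`ψ₁₃ : A₁ → A₃`, `ψ₂₄ : A₂ → A₄` (level maps) and `φ₃₄ : A₃ → A₄` (target reduction) with `ψ₂₄ ∘ φ₁₂ = φ₃₄ ∘ ψ₁₃`, and
module maps with `g₂₄ ∘ r₁₂ = r₃₄ ∘ g₁₃` pointwise, the four `coeffTwistReduce`s commute:
`f₂₄ (red₁₂ x) = red₃₄ (f₁₃ x)`. [cite: Howard2004HeegnerKolyvagin, Rem. 1.2.4 (arXiv p. 7, L13–27) and §1.6 (arXiv p. 12, L29–33)] -/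
theorem coeffTwistReduce_comp_eq_of (φ₁₂ : A₁ →+* A₂) (h₁₂ : φ₁₂ u₁ = u₂) (ψ₁₃ : A₁ →+* A₃) (k₁₃ : ψ₁₃ u₁ = u₃)
    (ψ₂₄ : A₂ →+* A₄) (k₂₄ : ψ₂₄ u₂ = u₄) (φ₃₄ : A₃ →+* A₄) (h₃₄ : φ₃₄ u₃ = u₄)
    (hsq : ψ₂₄.comp φ₁₂ = φ₃₄.comp ψ₁₃)
    (r₁₂ : ρ₁.toContRepresentation →ⁱL ρ₂.toContRepresentation) (g₁₃ : ρ₁.toContRepresentation →ⁱL ρ₃.toContRepresentation)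
    (g₂₄ : ρ₂.toContRepresentation →ⁱL ρ₄.toContRepresentation) (r₃₄ : ρ₃.toContRepresentation →ⁱL ρ₄.toContRepresentation)
    (hsq' : ∀ a, g₂₄ (r₁₂ a) = r₃₄ (g₁₃ a)) (x : CoeffExtension ℤ A₁ M₁) :
    κ.coeffTwistReduce hu₂ hu₄ ψ₂₄ k₂₄ g₂₄ (κ.coeffTwistReduce hu₁ hu₂ φ₁₂ h₁₂ r₁₂ x) =
      κ.coeffTwistReduce hu₃ hu₄ φ₃₄ h₃₄ r₃₄ (κ.coeffTwistReduce hu₁ hu₃ ψ₁₃ k₁₃ g₁₃ x) := by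
  rw [coeffTwistReduce_comp_apply, coeffTwistReduce_comp_apply]
  exact κ.coeffTwistReduce_congr hu₁ hu₄ _ _ hsq (fun a ↦ hsq' a) x

end Literature.NumberTheory.EllipticCurves.ZpExtension

end
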